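import Summits.PneNP.PneNP.Theorems.ChebyshevTracialDesignUnconstrainedSquareSlack
import Summits.PneNP.PneNP.Theorems.ChebyshevTracialDesignVirtualReduction
import Summits.PneNP.PneNP.Theorems.ChebyshevTracialDesignNowhereZeroPadding
import Summits.PneNP.PneNP.Theses.ChebyshevTracialDesign
import HarnessLib

/-!
# Cell pnp-psdrank, route `ChebyshevTracialDesign`: the crux `TracialDecayExp20` is EQUIVALENT to its TIGHTNESS-FREE form —
# the orthogonality clause `X_U · Y_M = 0` on the tight pairs can be deleted from the crux without changing its truth
# (crux stmt-PneNP-19878; leaf file, imports the route file — nothing should import this)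

Brick 84 (prover g15). The crux quantifies over TIGHT-ORTHOGONAL psd rectangles (`IsPsdRect X Y`: `0 ⪯ X_U, Y_M ⪯ I` AND
`X_U Y_M = 0` whenever `cc(U,M) = 1`). This file proves, by name and in the kernel,

  `TracialDecayExp20 ↔ ∃ a > 0, ∀ large even n, ∀ balanced B = 20 designs (t, C, w), ∀ r ≥ 1 with r²n < exp(a·dq n),
     ∀ families of psd CONTRACTIONS X_U, Y_M of dimension r (NO orthogonality condition at all):
       (1/r)·Σ_{U,M} levelWeight(U,M)·tr(X_U Y_M) ≤ exp(−a·dq n)`                          (`tracialDecayExp20_iff_contractions`).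

So the only place where the combinatorics of "exactly one crossing edge" enters the STRATEGY CLASS of the crux is inessential: with the SAME
designs and the SAME weight (no `(cc−1)²` reweighting, cf. brick 42), the crux is a statement about arbitrary contraction-valued pairs
`U ↦ X_U`, `M ↦ Y_M`. Mechanism. `←` is restriction. `→`: brick 42 (`…UnconstrainedSquareSlack.unconstrained_sqSlack_decay_of_crux`: the
Kronecker lift by the slack Gram strategy makes ANY contraction pair tight at the price of the factor `(cc−1)²` in the kernel and `m = C(n,2)+1`
in the dimension) gives decay of the TWISTED weight `W·(cc−1)²`; the twist is then removed by the tracial profile polynomial at degree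
`dq n − 2` (brick 20, `…TracialProfilePolynomial.tracial_profile_polynomial_of_contractions`, which uses no tightness): the level profile
`Φ(c) = Σ_{Q_c} tr(X_U Y_M)` is `|Q_c|·P(c) ± |Q_c|·r·√P_{D−2}` with `deg P ≤ D − 2`, and an exact design of degree `D` prices BOTH `P` and
`(c−1)²·P` at `−P(0)` (exactness for `P` and for `(X−1)²P`, the latter evaluating to `(0−1)²P(0) = P(0)` at the virtual level), so
`Σ W·tr(XY)` and `Σ W·(cc−1)²·tr(XY)` differ by at most `20·Tq(n)²·r·√P_{dq n−2} = r·exp(−Ω(dq n·log n))` (`value_le_sqSlack_value_add`,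
§2). The polynomial losses (`m³` in the value, `m` in the dimension, `Tq²·√n` in the tail) cost `a ↦ a/2` (§3).
Reading (MEMO-18 §1): the dense-cell / synchronisation / alignment programme (bricks 51–82) studies how tightness propagates; this equivalence
says the crux can be attacked — and refuted — with tightness ignored: it is the statement that no pair of contraction-valued maps of
dimension `< exp(a·dq n/2)` has a level profile on the odd levels `3 … Tq n` whose degree-`dq n` extrapolation to the virtual level `0` is
below `−exp(−a·dq n)` (MEMO-12 §4(b) made precise and closed into an `iff`).
[cite: Rothvoss2017, §2 (PDF pp. 5–6)] [cite: BrietDadushPokutta2014, Thm. 6 (§3)] [cite: GriblingDelaatLaurent2019, §5]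
[cite: CoppersmithRivlin1992, Thm. (p. 970)]
Stature: support/instrument (a reformulation of the OPEN crux). WHAT THIS IS NOT: neither a proof nor a refutation of `TracialDecayExp20`,
nothing on psd rank of P_PM(K_n), no P-vs-NP content.
-/

set_option linter.dupNamespace false -- `Summit.PneNP.PneNP.…`: summit = sub-problem (D-0017)

noncomputable section

namespace Summit.PneNP.PneNP.Theorems.ChebyshevTracialDesignTightnessFree

open Finset Matrix Polynomial Literature.Barriers.PneNP Literature.Combinatorics.Optimization
open Summit.PneNP.PneNP.Theorems.ChebyshevTracialDesignUnconstrainedSquareSlack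
open Summit.PneNP.PneNP.Theorems.ChebyshevTracialDesignVirtualReduction
open Summit.PneNP.PneNP.Theorems.ChebyshevTracialDesignNowhereZeroPadding
open Summit.PneNP.PneNP.Theorems.ChebyshevTracialDesignTracialProfilePolynomial
open Summit.PneNP.PneNP.Theorems.ChebyshevTracialDesignProfileExtrapolation
open Summit.PneNP.PneNP.Theorems.ChebyshevTracialDesignBoundedDim (le_dq_of_pow_le)

variable {n : ℕ}

/-! ### §1 Level-sum bookkeeping -/

/-- The design value of any kernel as a weighted sum of its level sums `Φ(c) = Σ_{(U,M) ∈ Q_c(t)} g(U,M)`.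
[cite: Rothvoss2017, §2 (PDF p. 6)] -/
theorem value_eq_sum_Qset (t : ℕ) (C : Finset ℕ) (w : ℕ → ℝ) (g : OddSet n → PMatch n → ℝ) :
    ∑ U : OddSet n, ∑ M : PMatch n, levelWeight n t C w U M * g U M =
      ∑ c ∈ C, w c / ((Qset n t c).card : ℝ) * ∑ q ∈ Qset n t c, g q.1 q.2 := by
  rw [value_eq_level_sums]
  exact sum_congr rfl fun c _ => by rw [level_sum_eq_sum_Qset]

/-- On the level class `Q_c(t)` the squared slack is the constant `(c−1)²`: the design value of the twisted kernel
`(cc−1)²·g` is `Σ_c (w_c/|Q_c|)·(c−1)²·Φ(c)`. [cite: Rothvoss2017, §2 (PDF pp. 5–6)] -/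
theorem sqSlack_value_eq_sum_Qset (t : ℕ) (C : Finset ℕ) (w : ℕ → ℝ) (g : OddSet n → PMatch n → ℝ) :
    ∑ U : OddSet n, ∑ M : PMatch n, levelWeight n t C w U M * pmOddCutSlack n U M ^ 2 * g U M =
      ∑ c ∈ C, w c / ((Qset n t c).card : ℝ) * (((c : ℝ) - 1) ^ 2 * ∑ q ∈ Qset n t c, g q.1 q.2) := by
  have h1 : ∑ U : OddSet n, ∑ M : PMatch n, levelWeight n t C w U M * pmOddCutSlack n U M ^ 2 * g U M =
      ∑ U : OddSet n, ∑ M : PMatch n, levelWeight n t C w U M * (pmOddCutSlack n U M ^ 2 * g U M) :=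
    sum_congr rfl fun U _ => sum_congr rfl fun M _ => by ring
  rw [h1, value_eq_sum_Qset]
  refine sum_congr rfl fun c _ => ?_
  congr 1
  rw [mul_sum]
  refine sum_congr rfl fun q hq => ?_
  rw [pmOddCutSlack_apply, (mem_Qset_iff.1 hq).2]

/-! ### §2 The comparison lemma: an exact design prices `tr(XY)` and `(cc−1)²·tr(XY)` identically, up to the deep tail -/

/-- For an odd level `c` with `3 ≤ c ≤ T`: `|1 − (c−1)²| ≤ T²`. -/
theorem abs_one_sub_sq_le {c T : ℕ} (h3 : 3 ≤ c) (hcT : c ≤ T) : |(1 : ℝ) - ((c : ℝ) - 1) ^ 2| ≤ (T : ℝ) ^ 2 := by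
  have hc : (3 : ℝ) ≤ c := by exact_mod_cast h3
  have hT : (c : ℝ) ≤ T := by exact_mod_cast hcT
  rw [abs_le]
  constructor <;> nlinarith

/-- **COMPARISON LEMMA (no tightness).** Let `n` be even, `(n, t = 2c'+1, T, D, B_v, C, w)` an exact design, `D' + 2 ≤ D`, `D' ≤ 2c'`, and
`X_U, Y_M` ANY families of psd contractions of dimension `r`. Then
`Σ_{U,M} W(U,M)·tr(X_U Y_M) ≤ Σ_{U,M} W(U,M)·(cc(U,M)−1)²·tr(X_U Y_M) + B_v·T²·r·√P_{D'}`, `P_{D'} = Π_{i ≤ D'/2} (2i+1)/(n−2i)`: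
by the tracial profile polynomial (degree `≤ D'`, tail `|Q_c|·r·√P_{D'}` at every odd level) and exactness applied to `P` and to
`(1 − (X−1)²)·P` (degree `≤ D`, vanishing at the virtual level `0`), the two design values have the same main term `−P(0)`.
[cite: Rothvoss2017, §2 (PDF p. 6)] [cite: CoppersmithRivlin1992, Thm. (p. 970)] [cite: GriblingDelaatLaurent2019, §5] -/
theorem value_le_sqSlack_value_add {c' T D D' r : ℕ} {Bv : ℝ} {C : Finset ℕ} {w : ℕ → ℝ} (hn : Even n)
    (hdes : IsExactDesign n (2 * c' + 1) T D Bv C w) (hD' : D' + 2 ≤ D) (hD'c : D' ≤ 2 * c')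
    (X : OddSet n → Matrix (Fin r) (Fin r) ℝ) (Y : PMatch n → Matrix (Fin r) (Fin r) ℝ)
    (hX : ∀ U, (X U).PosSemidef ∧ (1 - X U).PosSemidef) (hY : ∀ M, (Y M).PosSemidef ∧ (1 - Y M).PosSemidef) :
    ∑ U : OddSet n, ∑ M : PMatch n, levelWeight n (2 * c' + 1) C w U M * (X U * Y M).trace ≤
      ∑ U : OddSet n, ∑ M : PMatch n, levelWeight n (2 * c' + 1) C w U M * pmOddCutSlack n U M ^ 2 * (X U * Y M).trace +
        Bv * (T : ℝ) ^ 2 * ((r : ℝ) * Real.sqrt (∏ i ∈ range (D' / 2 + 1), ((2 * i + 1 : ℝ) / ((n : ℝ) - 2 * i)))) := by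
  classical
  have ht : 2 * (2 * c' + 1) + 2 ≤ n := hdes.2.1
  have hTt : T ≤ 2 * c' + 1 := hdes.2.2.1
  have hC := hdes.2.2.2.1
  have hexact := hdes.2.2.2.2.2.1
  have hBv := hdes.2.2.2.2.2.2
  obtain ⟨p, P, -, -, hdeg, -, hlev⟩ := tracial_profile_polynomial_of_contractions hn ht hD'c X Y hX hY
  set τ : ℝ := (r : ℝ) * Real.sqrt (∏ i ∈ range (D' / 2 + 1), ((2 * i + 1 : ℝ) / ((n : ℝ) - 2 * i))) with hτ
  have hτ0 : 0 ≤ τ := by positivity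
  set Φ : ℕ → ℝ := fun c => ∑ q ∈ Qset n (2 * c' + 1) c, (X q.1 * Y q.2).trace with hΦ
  rw [value_eq_sum_Qset, sqSlack_value_eq_sum_Qset]
  -- the polynomial `(1 − (X − 1)²)·P` has degree `≤ D` and vanishes at `0`
  set Q : Polynomial ℝ := (Polynomial.C 1 - (Polynomial.X - Polynomial.C 1) ^ 2) * P with hQ
  have hQdeg : Q.natDegree ≤ D := by
    have h1 : (Polynomial.C (1 : ℝ) - (Polynomial.X - Polynomial.C 1) ^ 2).natDegree ≤ 2 := by
      refine (natDegree_sub_le _ _).trans (max_le (by simp) ?_)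
      refine (natDegree_pow_le).trans ?_
      rw [natDegree_X_sub_C]
    calc Q.natDegree ≤ (Polynomial.C (1 : ℝ) - (Polynomial.X - Polynomial.C 1) ^ 2).natDegree + P.natDegree := natDegree_mul_le
      _ ≤ 2 + D' := Nat.add_le_add h1 hdeg
      _ ≤ D := by omega
  have hQeval : ∀ x : ℝ, Q.eval x = (1 - (x - 1) ^ 2) * P.eval x := fun x => by
    rw [hQ]; simp [eval_mul, eval_sub, eval_pow, eval_X]
  have hQ0 : ∑ c ∈ C, w c * ((1 - ((c : ℝ) - 1) ^ 2) * P.eval (c : ℝ)) = 0 := by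
    have h := hexact Q hQdeg
    simp_rw [hQeval] at h
    rw [h]; norm_num
  -- termwise: `(w_c/|Q_c|)·(1 − (c−1)²)·Φ_c = w_c (1−(c−1)²) P(c) + (w_c/|Q_c|)(1−(c−1)²)(Φ_c − |Q_c| P(c))`
  have hterm : ∀ c ∈ C, w c / ((Qset n (2 * c' + 1) c).card : ℝ) * Φ c -
      w c / ((Qset n (2 * c' + 1) c).card : ℝ) * ((((c : ℝ) - 1) ^ 2) * Φ c) ≤
      w c * ((1 - ((c : ℝ) - 1) ^ 2) * P.eval (c : ℝ)) + |w c| * (T : ℝ) ^ 2 * τ := by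
    intro c hc
    obtain ⟨⟨m, hm⟩, h3, hcT, hne⟩ := hC c hc
    have hmc : m ≤ c' := by omega
    have hQpos : (0 : ℝ) < ((Qset n (2 * c' + 1) c).card : ℝ) := by exact_mod_cast card_pos.2 hne
    have h1 : |Φ c - ((Qset n (2 * c' + 1) c).card : ℝ) * P.eval (c : ℝ)| ≤ ((Qset n (2 * c' + 1) c).card : ℝ) * τ := by
      have h0 := hlev m hmc
      rw [← hm] at h0
      simpa only [hΦ] using h0
    have heq : w c / ((Qset n (2 * c' + 1) c).card : ℝ) * Φ c -
        w c / ((Qset n (2 * c' + 1) c).card : ℝ) * ((((c : ℝ) - 1) ^ 2) * Φ c) -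
        w c * ((1 - ((c : ℝ) - 1) ^ 2) * P.eval (c : ℝ)) =
        w c / ((Qset n (2 * c' + 1) c).card : ℝ) * (1 - ((c : ℝ) - 1) ^ 2) *
          (Φ c - ((Qset n (2 * c' + 1) c).card : ℝ) * P.eval (c : ℝ)) := by
      field_simp
    have hbound : |w c / ((Qset n (2 * c' + 1) c).card : ℝ) * (1 - ((c : ℝ) - 1) ^ 2) *
        (Φ c - ((Qset n (2 * c' + 1) c).card : ℝ) * P.eval (c : ℝ))| ≤ |w c| * (T : ℝ) ^ 2 * τ := by
      rw [abs_mul, abs_mul, abs_div, Nat.abs_cast]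
      calc |w c| / ((Qset n (2 * c' + 1) c).card : ℝ) * |1 - ((c : ℝ) - 1) ^ 2| *
            |Φ c - ((Qset n (2 * c' + 1) c).card : ℝ) * P.eval (c : ℝ)|
          ≤ |w c| / ((Qset n (2 * c' + 1) c).card : ℝ) * (T : ℝ) ^ 2 * (((Qset n (2 * c' + 1) c).card : ℝ) * τ) := by
            refine mul_le_mul (mul_le_mul_of_nonneg_left (abs_one_sub_sq_le h3 hcT) (div_nonneg (abs_nonneg _) hQpos.le))
              h1 (abs_nonneg _) ?_
            exact mul_nonneg (div_nonneg (abs_nonneg _) hQpos.le) (sq_nonneg _)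
        _ = |w c| * (T : ℝ) ^ 2 * τ := by field_simp
    have := (abs_le.1 hbound).2
    linarith
  -- sum the termwise bounds
  have hsum := sum_le_sum hterm
  rw [sum_sub_distrib, sum_add_distrib, hQ0, zero_add, ← sum_mul, ← sum_mul] at hsum
  have hB : (∑ c ∈ C, |w c|) * (T : ℝ) ^ 2 * τ ≤ Bv * (T : ℝ) ^ 2 * τ :=
    mul_le_mul_of_nonneg_right (mul_le_mul_of_nonneg_right hBv (sq_nonneg _)) hτ0
  linarith

/-! ### §3 Asymptotic bookkeeping: the polynomial losses of the Kronecker lift and of the tail are absorbed by `a ↦ a/2` -/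

/-- The dimension of the slack Gram strategy is polynomial in `dq n`: `m = |Edge n ⊕ Unit| ≤ 2·(dq n + 1)⁸`. -/
theorem card_edge_unit_le (n : ℕ) : (Fintype.card (Edge n ⊕ Unit) : ℝ) ≤ 2 * ((dq n : ℝ) + 1) ^ 8 := by
  have h1 : Fintype.card (Edge n ⊕ Unit) ≤ Fintype.card (Option (Sym2 (Fin n))) := by
    rw [Fintype.card_sum, Fintype.card_unit, Fintype.card_option]
    exact Nat.add_le_add_right (Fintype.card_subtype_le _) 1
  have h2 : (Fintype.card (Edge n ⊕ Unit) : ℝ) ≤ Fintype.card (Option (Sym2 (Fin n))) := by exact_mod_cast h1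
  exact h2.trans (card_option_sym2_le n)

/-- `Tq n ≤ 7·(dq n + 1)²` (from `⌊√n⌋ < (dq n + 1)²`). [cite: CoppersmithRivlin1992, Thm. (p. 970); elementary] -/
theorem Tq_le (n : ℕ) : (Tq n : ℝ) ≤ 7 * ((dq n : ℝ) + 1) ^ 2 := by
  have h1 : Nat.sqrt n < (dq n + 1) ^ 2 := by
    have := Nat.lt_succ_sqrt' (Nat.sqrt n); rw [dq]; simpa [sq] using this
  have h2 : Tq n ≤ 7 * (dq n + 1) ^ 2 := by
    unfold Tq
    have : 1 ≤ (dq n + 1) ^ 2 := Nat.one_le_pow _ _ (by omega)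
    omega
  exact_mod_cast h2

/-- The attenuation product at degree `D − 2` is at most `n` times the one at degree `D` (`2 ≤ D`, `2D < n`): the extra factor of
`P_D` is `(2(D/2)+1)/(n − 2(D/2)) ≥ 1/n`. -/
theorem prod_atten_sub_two_le {D : ℕ} (hD : 2 ≤ D) (hDn : 2 * D < n) :
    ∏ i ∈ range ((D - 2) / 2 + 1), ((2 * i + 1 : ℝ) / ((n : ℝ) - 2 * i)) ≤
      (n : ℝ) * ∏ i ∈ range (D / 2 + 1), ((2 * i + 1 : ℝ) / ((n : ℝ) - 2 * i)) := by
  have hk : (D - 2) / 2 + 1 = D / 2 := by omega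
  rw [hk, prod_range_succ]
  set Pr := ∏ i ∈ range (D / 2), ((2 * i + 1 : ℝ) / ((n : ℝ) - 2 * i)) with hPr
  have hPr0 : 0 ≤ Pr := by
    refine prod_nonneg fun i hi => div_nonneg (by positivity) ?_
    have : ((2 * i : ℕ) : ℝ) < n := by
      have := mem_range.1 hi; exact_mod_cast (show 2 * i < n by omega)
    push_cast at this; linarith
  have hden : (0 : ℝ) < (n : ℝ) - 2 * ((D / 2 : ℕ) : ℝ) := by
    have : ((2 * (D / 2) : ℕ) : ℝ) < n := by exact_mod_cast (show 2 * (D / 2) < n by omega)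
    push_cast at this; linarith
  have hfac : (1 : ℝ) ≤ (n : ℝ) * ((2 * ((D / 2 : ℕ) : ℝ) + 1) / ((n : ℝ) - 2 * ((D / 2 : ℕ) : ℝ))) := by
    rw [mul_div_assoc', le_div_iff₀ hden]
    have hn0 : (0 : ℝ) ≤ n := Nat.cast_nonneg n
    have hd0 : (0 : ℝ) ≤ ((D / 2 : ℕ) : ℝ) := Nat.cast_nonneg _
    nlinarith
  calc Pr = Pr * 1 := (mul_one _).symm
    _ ≤ Pr * ((n : ℝ) * ((2 * ((D / 2 : ℕ) : ℝ) + 1) / ((n : ℝ) - 2 * ((D / 2 : ℕ) : ℝ)))) :=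
        mul_le_mul_of_nonneg_left hfac hPr0
    _ = (n : ℝ) * (Pr * ((2 * ((D / 2 : ℕ) : ℝ) + 1) / ((n : ℝ) - 2 * ((D / 2 : ℕ) : ℝ)))) := by ring


/-- **All thresholds at once.** For `a > 0` there is `n₀` such that for every `n ≥ n₀`, with `D = dq n`, `m = |Edge n ⊕ Unit| = C(n,2)+1`,
`T = Tq n`: `2 ≤ D`, `2D < n`, `m² ≤ exp(aD/2)`, `m³·exp(−aD) ≤ exp(−aD/2)/2` and `20·T²·√P_{D−2} ≤ exp(−aD/2)/2` — the polynomial losses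
of the Kronecker lift (dimension `m`, value `m³`) and the deep tail of the comparison lemma are absorbed by halving the rate.
[cite: CoppersmithRivlin1992, Thm. (p. 970)] -/
theorem exists_thresholds_tf {a : ℝ} (ha : 0 < a) : ∃ n₀ : ℕ, ∀ n : ℕ, n₀ ≤ n →
    2 ≤ dq n ∧ 2 * dq n < n ∧
    (Fintype.card (Edge n ⊕ Unit) : ℝ) ^ 2 ≤ Real.exp (a / 2 * (dq n : ℝ)) ∧
    (Fintype.card (Edge n ⊕ Unit) : ℝ) ^ 3 * Real.exp (-(a * (dq n : ℝ))) ≤ Real.exp (-(a / 2 * (dq n : ℝ))) / 2 ∧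
    20 * (Tq n : ℝ) ^ 2 * Real.sqrt (∏ i ∈ range ((dq n - 2) / 2 + 1), ((2 * i + 1 : ℝ) / ((n : ℝ) - 2 * i))) ≤
      Real.exp (-(a / 2 * (dq n : ℝ))) / 2 := by
  obtain ⟨D₁, hD₁⟩ := exists_mul_pow_le_exp (show 0 < a / 2 by positivity) (show (0 : ℝ) < 4 by norm_num) 16
  obtain ⟨D₂, hD₂⟩ := exists_mul_pow_le_exp (show 0 < a / 2 by positivity) (show (0 : ℝ) < 16 by norm_num) 24
  obtain ⟨D₃, hD₃⟩ := exists_mul_pow_le_exp one_pos (show (0 : ℝ) < 49 by norm_num) 6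
  obtain ⟨n₄, hn₄⟩ := sqrt_prod_atten_small (show 0 < a / 2 + 1 by positivity)
  refine ⟨max ((max 2 (max D₁ (max D₂ D₃))) ^ 4) n₄, fun n hn => ?_⟩
  have hn4 : n₄ ≤ n := le_trans (le_max_right _ _) hn
  have hDall : max 2 (max D₁ (max D₂ D₃)) ≤ dq n := le_dq_of_pow_le (le_trans (le_max_left _ _) hn)
  simp only [max_le_iff] at hDall
  obtain ⟨hD2, hDD₁, hDD₂, hDD₃⟩ := hDall
  obtain ⟨h2D, htail⟩ := hn₄ n hn4
  set D := dq n with hDdef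
  set m : ℝ := (Fintype.card (Edge n ⊕ Unit) : ℝ) with hmdef
  have hm0 : 0 ≤ m := by rw [hmdef]; positivity
  have hm : m ≤ 2 * ((D : ℝ) + 1) ^ 8 := card_edge_unit_le n
  have hD0 : (0 : ℝ) ≤ (D : ℝ) + 1 := by positivity
  refine ⟨hD2, h2D, ?_, ?_, ?_⟩
  · -- `m² ≤ 4(D+1)^16 ≤ exp(aD/2)`
    calc m ^ 2 ≤ (2 * ((D : ℝ) + 1) ^ 8) ^ 2 := by gcongr
      _ = 4 * ((D : ℝ) + 1) ^ 16 := by ring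
      _ ≤ Real.exp (a / 2 * (D : ℝ)) := hD₁ D hDD₁
  · -- `m³ e^{−aD} ≤ (e^{aD/2}/2) e^{−aD} = e^{−aD/2}/2`
    have h3 : m ^ 3 ≤ Real.exp (a / 2 * (D : ℝ)) / 2 := by
      calc m ^ 3 ≤ (2 * ((D : ℝ) + 1) ^ 8) ^ 3 := by gcongr
        _ = (16 * ((D : ℝ) + 1) ^ 24) / 2 := by ring
        _ ≤ Real.exp (a / 2 * (D : ℝ)) / 2 := by gcongr; exact hD₂ D hDD₂
    have hsplit : Real.exp (a / 2 * (D : ℝ)) * Real.exp (-(a * (D : ℝ))) = Real.exp (-(a / 2 * (D : ℝ))) := by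
      rw [← Real.exp_add]; ring_nf
    calc m ^ 3 * Real.exp (-(a * (D : ℝ))) ≤ Real.exp (a / 2 * (D : ℝ)) / 2 * Real.exp (-(a * (D : ℝ))) :=
          mul_le_mul_of_nonneg_right h3 (Real.exp_pos _).le
      _ = Real.exp (-(a / 2 * (D : ℝ))) / 2 := by rw [div_mul_eq_mul_div, hsplit]
  · -- `20 T² √P_{D−2} ≤ 20·49(D+1)⁴·(D+1)²·√P_D ≤ 49 (D+1)⁶ e^{−(a/2+1)D}/2 ≤ e^{−aD/2}/2`
    have hT : (Tq n : ℝ) ≤ 7 * ((D : ℝ) + 1) ^ 2 := Tq_le n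
    have hT0 : (0 : ℝ) ≤ Tq n := Nat.cast_nonneg _
    set PD := ∏ i ∈ range (D / 2 + 1), ((2 * i + 1 : ℝ) / ((n : ℝ) - 2 * i)) with hPD
    have hPD0 : 0 ≤ PD := Summit.PneNP.PneNP.Theorems.ChebyshevTracialDesignProfilePolynomial.prod_atten_nonneg (by omega)
    have hP2 : ∏ i ∈ range ((D - 2) / 2 + 1), ((2 * i + 1 : ℝ) / ((n : ℝ) - 2 * i)) ≤ (n : ℝ) * PD :=
      prod_atten_sub_two_le hD2 h2D
    have hnD : (n : ℝ) ≤ (((D : ℝ) + 1) ^ 2) ^ 2 := by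
      have := natCast_succ_le_dq_succ_pow_four n; rw [← hDdef] at this; nlinarith
    have hsqrt : Real.sqrt (∏ i ∈ range ((D - 2) / 2 + 1), ((2 * i + 1 : ℝ) / ((n : ℝ) - 2 * i))) ≤
        ((D : ℝ) + 1) ^ 2 * Real.sqrt PD := by
      calc Real.sqrt (∏ i ∈ range ((D - 2) / 2 + 1), ((2 * i + 1 : ℝ) / ((n : ℝ) - 2 * i)))
          ≤ Real.sqrt ((n : ℝ) * PD) := Real.sqrt_le_sqrt hP2
        _ = Real.sqrt (n : ℝ) * Real.sqrt PD := Real.sqrt_mul (Nat.cast_nonneg n) PD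
        _ ≤ Real.sqrt ((((D : ℝ) + 1) ^ 2) ^ 2) * Real.sqrt PD :=
            mul_le_mul_of_nonneg_right (Real.sqrt_le_sqrt hnD) (Real.sqrt_nonneg _)
        _ = ((D : ℝ) + 1) ^ 2 * Real.sqrt PD := by rw [Real.sqrt_sq (by positivity)]
    have h49 : 49 * ((D : ℝ) + 1) ^ 6 ≤ Real.exp (1 * (D : ℝ)) := hD₃ D hDD₃
    have hsplit : Real.exp (1 * (D : ℝ)) * Real.exp (-((a / 2 + 1) * (D : ℝ))) = Real.exp (-(a / 2 * (D : ℝ))) := by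
      rw [← Real.exp_add]; ring_nf
    calc 20 * (Tq n : ℝ) ^ 2 * Real.sqrt (∏ i ∈ range ((D - 2) / 2 + 1), ((2 * i + 1 : ℝ) / ((n : ℝ) - 2 * i)))
        ≤ 20 * (7 * ((D : ℝ) + 1) ^ 2) ^ 2 * (((D : ℝ) + 1) ^ 2 * Real.sqrt PD) := by gcongr
      _ = 49 * ((D : ℝ) + 1) ^ 6 * (20 * Real.sqrt PD) := by ring
      _ ≤ Real.exp (1 * (D : ℝ)) * (Real.exp (-((a / 2 + 1) * (D : ℝ))) / 2) :=
          mul_le_mul h49 htail (by positivity) (Real.exp_pos _).le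
      _ = Real.exp (-(a / 2 * (D : ℝ))) / 2 := by rw [mul_div_assoc', hsplit]

/-! ### §4 The equivalence: the orthogonality clause of `IsPsdRect` can be deleted from the crux -/

/-- **`TracialDecayExp20` ⇒ its tightness-free form.** If the crux holds (rate `a`, obtained through brick 42's Kronecker lift), then with rate
`a/2`: for all large even `n`, every balanced `B = 20` design `(t, C, w)`, every `r ≥ 1` with `r²n < exp((a/2)·dq n)` and ALL families of psd
contractions `X_U`, `Y_M` of dimension `r` (no orthogonality on the tight pairs), `(1/r)·Σ W·tr(X_U Y_M) ≤ exp(−(a/2)·dq n)`.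
[cite: Rothvoss2017, §2 (PDF pp. 5–6)] [cite: BrietDadushPokutta2014, Thm. 6 (§3)] [cite: GriblingDelaatLaurent2019, §5] -/
theorem contractionDecay_of_tracialDecayExp20 (hcrux : Summit.PneNP.PneNP.Theses.ChebyshevTracialDesign.TracialDecayExp20) :
    ∃ a : ℝ, 0 < a ∧ ∃ n₁ : ℕ, ∀ n : ℕ, n₁ ≤ n → Even n → ∀ (t : ℕ) (C : Finset ℕ) (w : ℕ → ℝ),
      IsBalancedDesign n t (Tq n) (dq n) 20 C w → ∀ r : ℕ, 0 < r → (r : ℝ) ^ 2 * n < Real.exp (a * (dq n : ℝ)) →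
        ∀ (X : OddSet n → Matrix (Fin r) (Fin r) ℝ) (Y : PMatch n → Matrix (Fin r) (Fin r) ℝ),
          (∀ U, (X U).PosSemidef ∧ (1 - X U).PosSemidef) → (∀ M, (Y M).PosSemidef ∧ (1 - Y M).PosSemidef) →
            (∑ U, ∑ M, levelWeight n t C w U M * (X U * Y M).trace) / r ≤ Real.exp (-(a * (dq n : ℝ))) := by
  obtain ⟨a, ha, n₁, h42⟩ := unconstrained_sqSlack_decay_of_crux hcrux
  obtain ⟨n₀, hn₀⟩ := exists_thresholds_tf ha
  refine ⟨a / 2, by positivity, max n₁ n₀, fun n hn hev t C w hdes r hr hbud X Y hX hY => ?_⟩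
  have hn1 : n₁ ≤ n := le_trans (le_max_left _ _) hn
  obtain ⟨hD2, -, hm2, hm3, htail⟩ := hn₀ n (le_trans (le_max_right _ _) hn)
  set D : ℝ := (dq n : ℝ) with hDdef
  set m : ℕ := Fintype.card (Edge n ⊕ Unit) with hmdef
  have hr' : (0 : ℝ) < r := by exact_mod_cast hr
  have hex : IsExactDesign n t (Tq n) (dq n) 20 C w := hdes.1
  obtain ⟨c', rfl⟩ : ∃ c', t = 2 * c' + 1 := hex.1
  -- the budget of the lifted strategy: `(m r)² n = m² (r² n) < m² e^{aD/2} ≤ e^{aD}`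
  have hmpos : (0 : ℝ) < (m : ℝ) := by
    have : 0 < m := Fintype.card_pos
    exact_mod_cast this
  have hbud' : ((m * r : ℕ) : ℝ) ^ 2 * n < Real.exp (a * (dq n : ℝ)) := by
    have hsplit : Real.exp (a / 2 * D) * Real.exp (a / 2 * D) = Real.exp (a * (dq n : ℝ)) := by
      rw [← Real.exp_add, hDdef]; ring_nf
    push_cast
    calc ((m : ℝ) * r) ^ 2 * n = (m : ℝ) ^ 2 * ((r : ℝ) ^ 2 * n) := by ring
      _ < (m : ℝ) ^ 2 * Real.exp (a / 2 * D) := mul_lt_mul_of_pos_left hbud (by positivity)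
      _ ≤ Real.exp (a / 2 * D) * Real.exp (a / 2 * D) := mul_le_mul_of_nonneg_right hm2 (Real.exp_pos _).le
      _ = Real.exp (a * (dq n : ℝ)) := hsplit
  -- brick 42: decay of the twisted weight `W·(cc−1)²` against `(X, Y)` (Kronecker lift by the slack Gram strategy)
  have hB := h42 n hn1 hev (2 * c' + 1) C w hdes r hr hbud' X Y hX hY
  -- the comparison lemma at degree `dq n − 2`
  have hD' : dq n - 2 + 2 ≤ dq n := by omega
  have hD'c : dq n - 2 ≤ 2 * c' := by
    have h1 := dq_add_three_le_Tq n
    have h2 : Tq n ≤ 2 * c' + 1 := hex.2.2.1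
    omega
  have hcmp := value_le_sqSlack_value_add hev hex hD' hD'c X Y hX hY
  -- assemble
  rw [div_le_iff₀ hr'] at hB ⊢
  have htail' : (20 : ℝ) * (Tq n : ℝ) ^ 2 *
      ((r : ℝ) * Real.sqrt (∏ i ∈ range ((dq n - 2) / 2 + 1), ((2 * i + 1 : ℝ) / ((n : ℝ) - 2 * i)))) ≤
      Real.exp (-(a / 2 * D)) / 2 * r := by
    have h := mul_le_mul_of_nonneg_right htail hr'.le
    calc (20 : ℝ) * (Tq n : ℝ) ^ 2 *
          ((r : ℝ) * Real.sqrt (∏ i ∈ range ((dq n - 2) / 2 + 1), ((2 * i + 1 : ℝ) / ((n : ℝ) - 2 * i))))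
        = 20 * (Tq n : ℝ) ^ 2 *
          Real.sqrt (∏ i ∈ range ((dq n - 2) / 2 + 1), ((2 * i + 1 : ℝ) / ((n : ℝ) - 2 * i))) * r := by ring
      _ ≤ Real.exp (-(a / 2 * D)) / 2 * r := h
  have hm3' : (m : ℝ) ^ 3 * Real.exp (-(a * (dq n : ℝ))) * r ≤ Real.exp (-(a / 2 * D)) / 2 * r :=
    mul_le_mul_of_nonneg_right hm3 hr'.le
  linarith

/-- **The tightness-free form ⇒ `TracialDecayExp20`** (restriction: a tight-orthogonal psd rectangle is a pair of contraction families).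
[cite: BrietDadushPokutta2014, Thm. 6 (§3)] -/
theorem tracialDecayExp20_of_contractionDecay
    (h : ∃ a : ℝ, 0 < a ∧ ∃ n₁ : ℕ, ∀ n : ℕ, n₁ ≤ n → Even n → ∀ (t : ℕ) (C : Finset ℕ) (w : ℕ → ℝ),
      IsBalancedDesign n t (Tq n) (dq n) 20 C w → ∀ r : ℕ, 0 < r → (r : ℝ) ^ 2 * n < Real.exp (a * (dq n : ℝ)) →
        ∀ (X : OddSet n → Matrix (Fin r) (Fin r) ℝ) (Y : PMatch n → Matrix (Fin r) (Fin r) ℝ),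
          (∀ U, (X U).PosSemidef ∧ (1 - X U).PosSemidef) → (∀ M, (Y M).PosSemidef ∧ (1 - Y M).PosSemidef) →
            (∑ U, ∑ M, levelWeight n t C w U M * (X U * Y M).trace) / r ≤ Real.exp (-(a * (dq n : ℝ)))) :
    Summit.PneNP.PneNP.Theses.ChebyshevTracialDesign.TracialDecayExp20 := by
  obtain ⟨a, ha, n₁, h⟩ := h
  exact ⟨a, ha, n₁, fun n hn hev t C w hdes r hr hbud X Y hXY => h n hn hev t C w hdes r hr hbud X Y hXY.1 hXY.2.1⟩

/-- **THE CRUX IS EQUIVALENT TO ITS TIGHTNESS-FREE FORM.** `TracialDecayExp20` holds iff, for some `a > 0` and all large even `n`, every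
balanced `B = 20` design weight has normalised tracial value `≤ exp(−a·dq n)` on ALL pairs of families of psd contractions
`0 ⪯ X_U ⪯ I_r`, `0 ⪯ Y_M ⪯ I_r` of every dimension `r ≥ 1` with `r²n < exp(a·dq n)` — the orthogonality clause `X_U Y_M = 0` on the tight pairs
`|δ(U) ∩ M| = 1` deleted, the designs and the weight unchanged. [cite: Rothvoss2017, §2 (PDF pp. 5–6)] [cite: BrietDadushPokutta2014, Thm. 6 (§3)]
[cite: GriblingDelaatLaurent2019, §5] [cite: CoppersmithRivlin1992, Thm. (p. 970)] -/
theorem tracialDecayExp20_iff_contractions :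
    Summit.PneNP.PneNP.Theses.ChebyshevTracialDesign.TracialDecayExp20 ↔
    ∃ a : ℝ, 0 < a ∧ ∃ n₁ : ℕ, ∀ n : ℕ, n₁ ≤ n → Even n → ∀ (t : ℕ) (C : Finset ℕ) (w : ℕ → ℝ),
      IsBalancedDesign n t (Tq n) (dq n) 20 C w → ∀ r : ℕ, 0 < r → (r : ℝ) ^ 2 * n < Real.exp (a * (dq n : ℝ)) →
        ∀ (X : OddSet n → Matrix (Fin r) (Fin r) ℝ) (Y : PMatch n → Matrix (Fin r) (Fin r) ℝ),
          (∀ U, (X U).PosSemidef ∧ (1 - X U).PosSemidef) → (∀ M, (Y M).PosSemidef ∧ (1 - Y M).PosSemidef) →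
            (∑ U, ∑ M, levelWeight n t C w U M * (X U * Y M).trace) / r ≤ Real.exp (-(a * (dq n : ℝ))) :=
  ⟨contractionDecay_of_tracialDecayExp20, tracialDecayExp20_of_contractionDecay⟩

end Summit.PneNP.PneNP.Theorems.ChebyshevTracialDesignTightnessFree

end
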